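import Literature.AlgebraicGeometry.HodgeTheory.BlochSemiregularSpread
import Literature.AlgebraicGeometry.HodgeTheory.ComplexOrientationFamily
import HarnessLib

/-!
# Bloch's semiregularity theorem, class-level form, for a REDUCED local complete intersection with SMOOTH
# irreducible components (Bloch 1972 Thm. (7.4) with Remark (7.5); Buchweitz–Flenner 2003 Thm. 5.2 at `I = {p}`)

Topic `Literature/AlgebraicGeometry/HodgeTheory` (family `hodge`). NAMED FACT (D-0014), a sibling of
`BlochSemiregularSpread n p` (`BlochSemiregularSpread.lean`) requested by the venture cell `pub-hsemireg`
(OBJECT→THEOREM: exact semiregularity maps for explicit cycles; its STEP-0 object is Schoen's REDUCIBLE local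
complete intersection `Z = Δ_J ∪ (C × C) ⊂ J(C)²`, and its Prong C objects are unions `Δ_B ∪ T ⊂ B × B`).
The sibling renders the printed theorem for an INTEGRAL `Z`, so that "a class supported on `Z`" pins the
class to `μ·cl(Z)` by purity; Bloch's theorem assumes only that `Z₀` is "a local complete intersection of
codimension `p`" (no irreducibility: §0, (7.1), (7.3), (7.4)), and Buchweitz–Flenner's Thm. 5.2 any closed
subspace. This file renders the same printed statement for `Z` REDUCED whose irreducible components are
the images of finitely many SMOOTH projective `K_j ↪ X₀`: then the fundamental class is REAL in the tree,
`[Z] = Σ_j ι_{j*} 1_{K_j}` with the Gysin morphisms `complexGysin complexOrientationFamily` of the COMPLEX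
orientations (`ComplexGysin.lean`, `ComplexOrientationFamily.lean`; Fulton, Young Tableaux App. B §B.1/B.3:
the class "`[V]` in `H^{2c}X`" of a nonsingular `V ↪ X` is `ι_* 1_V`; Voisin I §11.1.2: the class of the
cycle `Σ nᵢ Zᵢ` is `Σ nᵢ [Zᵢ]`; Fulton §1.5: the cycle of a reduced pure-dimensional scheme is the sum of
its components with multiplicity `length 𝒪_{Z,η} = 1`), and no hypothesis structure or cycle-class map of
singular schemes is needed.

## Sources, verbatim (as in the sibling; Bloch read from the open GDZ scan of Invent. Math. 17)

* [Bloch1972Semiregularity] §0 (p. 51): "Let `Z ⊂ X` be a subscheme of codimension `p` which is a local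
  complete intersection. […] `Z` is said to be semi-regular if `π` is injective." (7.4) (p. 65): "Let
  `X →ᶠ S →ᵍ Spec(ℂ)` be morphisms, with `f` smooth and projective and `g` smooth, connected, and of finite
  type. Let `z ∈ Γ(S, R^{2p}f_*(Ω•_{X/S}))` be a horizontal section and let `o ∈ S`. Suppose the restricted
  class `z₀ ∈ H^{2p}_{DR}(X₀/ℂ)` is algebraic, representing a local complete intersection `Z₀ ⊂ X₀` which
  is semi-regular in `X₀`. Then for all `s ∈ S`, `z_s ∈ H^{2p}_{DR}(X_s/ℂ)` is algebraic." Proof, p. 65: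
  "Hence `Z₀` lifts to an analytic family over `U`, so `z_s` is algebraic for `s ∈ U`" (`U ∋ o` a complex
  neighbourhood — the LOCAL conclusion rendered here; the countable-union globalisation is the tree's
  `BlochSemiregularSpreadGlobal.lean`). (7.5): "The hypothesis on `z₀` in (7.4) can be weakened to read:
  there exist integers `a, b`, `a ≠ 0`, such that `a z₀ + b l₀^p` is the class of a subscheme `Z₀ ⊂ X₀`
  which is semi-regular and a local complete intersection." §1 (p. 52): `π` is the Grothendieck dual of
  `∧^{p-1}ε : H^{n-p-1}(X, Ω^{n-p+1}_X) → H^{n-p-1}(Z, ω_Z ⊗ N^*)` — the tree's `IsBlochSemiregular i n p`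
  (surjectivity of that map, `BlochSemiregularityMapReal.lean`).
* [BuchweitzFlenner2003] Thm. 5.2 (p. 25 of arXiv:math/9912245): "If there is an `I`-semiregular subspace
  `Z₀ ⊆ X₀` with `α_p(0) = ch_p(𝒪_{Z₀})` for `p ∈ I` then `α_p(s)` is algebraic for all `s ∈ S` near `0`";
  proof of Cor. 4.12 (p. 23): "`[Z] = ((-1)^{k-1}/(k-1)!) c_k(𝒪_Z) = ch_k(𝒪_Z)`"; (8.1)–Prop. 8.2: for a
  locally complete intersection `τ = τ_B` is Bloch's map.
* [FultonYoungTableaux1997] App. B §B.1 (5) and §B.3 (`[V] = ι_* 1` for nonsingular `V`); [Fulton1998] §1.5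
  (the cycle `[Z] = Σ m_i [Z_i]`, `m_i = length 𝒪_{Z, Z_i}`, `= 1` for `Z` reduced) and §19.1 (`cl`);
  [VoisinHodgeI2002] §11.1.2 (class of a cycle).

## Rendering (dictionary as in `BlochSemiregularSpread.lean` (D1)–(D5); only (D3) changes)

DATA: `f : 𝒳 ⟶ S` a smooth projective family of relative dimension `n` over a smooth quasi-projective `S`,
`s₀ ∈ S(ℂ)`, `e : X₀ ≅ 𝒳_{s₀}`, `X₀` smooth projective of dimension `n`; finitely many smooth projective
`K_j` of dimension `m` (`m + p = n`) with closed immersions `ι_j : K_j ↪ X₀` and pairwise distinct images; a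
closed subscheme `i : Z ↪ X₀` which is REDUCED, a local complete intersection of codimension `p`
(`IsRegularImmersionOfCodim i p`), with `|Z| = ⋃_j |ι_j(K_j)|` (so `Z` is pure of dimension `m` with
irreducible components exactly the `ι_j(K_j)`, each of multiplicity one) and Bloch-semiregular
(`IsBlochSemiregular i n p`); a global class `W ∈ H^{2p}(𝒳(ℂ); ℂ)` fibrewise rational of type `(p,p)` with
`e^*(W|_{𝒳_{s₀}}) = [Z] := Σ_j ι_{j*} 1_{K_j}` (complex orientations). CONCLUSION: `W|_{𝒳_t}` is algebraic
for all `t` in an open neighbourhood of `s₀` in `S(ℂ)`. (D3'): `[Z] = Σ_j cl(K_j) = ch_p(𝒪_Z)` is the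
class Bloch's `z₀` / BF's `α_p(0)` must be ("`z₀` is algebraic, representing `Z₀`"); the sign convention
`ε(m, n) = ±1` of the tree's complex orientations depends only on `(m, n)` (module docstring of
`ComplexOrientationFamily.lean`), so `Σ_j ι_{j*}1` is `±[Z]` uniformly, immaterial for algebraicity of the
flat section. The weakening (7.5) (`a z₀ + b l₀^p = [Z₀]`) is left to consumers, who put the polarization
powers into `W`.

## What is NOT here

No proof (named fact, like its sibling); components that are singular (would need the tree's resolution
cycle classes `cycleClass μ`, `CycleClassOfResolutions.lean`); non-reduced `Z` (multiplicities `length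
𝒪_{Z,η}`: `Motives/SubschemeCycles.fundamentalCycle`, whose local finiteness is itself a named fact);
BF's arbitrary closed subspaces. -- TODO(general form): BF Thm. 5.2 for any closed subspace `Z₀` with
`α_p(0) = ch_p(𝒪_{Z₀})` once `ch` of coherent sheaves has real carriers.
-/

noncomputable section

open CategoryTheory CategoryTheory.Limits AlgebraicGeometry
open Literature.AlgebraicTopology.SingularHomology

namespace Literature.AlgebraicGeometry.HodgeTheory

section Statement

open Literature.AlgebraicGeometry.Motives

/-- **The fundamental class of a smooth closed subvariety, complex orientations**: for `ι : K ⟶ X₀` with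
`K` smooth projective of dimension `m` and `X₀` smooth projective of dimension `n = m + p`, the class
`[K] := ι_* 1_K ∈ H^{2p}(X₀(ℂ); ℂ)`, `ι_*` the Gysin morphism of the COMPLEX orientation family (the tree's
REAL `complexGysin complexOrientationFamily`; "we get a class `[V]` in `H^{2n-2k}X`", the image of the
fundamental class under `ι(ℂ)_*` and Poincaré duality). A reducible abbreviation, no new notion.
[cite: FultonYoungTableaux1997, Appendix B §B.1 (5) and §B.3] [cite: VoisinHodgeI2002, §11.1.2] -/
abbrev smoothSubvarietyClass {m n p : ℕ} (hmn : m + p = n) {K X₀ : SchemeOver ℂ}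
    (hK : IsSmoothProjective m K) (hX₀ : IsSmoothProjective n X₀) (ι : K ⟶ X₀) : complexBetti X₀ (2 * p) :=
  complexGysin complexOrientationFamily hK hX₀ ι (show 0 + 2 * n = 2 * p + 2 * m by omega)
    (singularCohomology.one ℂ (ComplexPoints K))

/-- **Bloch's semiregularity theorem, class level, for a reduced local complete intersection with smooth
components (Bloch 1972 (7.4)/(7.5); Buchweitz–Flenner 2003 Thm. 5.2 at `I = {p}`).** PRINTED (Bloch (7.4)):
"Let `z ∈ Γ(S, R^{2p}f_*(Ω•_{X/S}))` be a horizontal section and let `o ∈ S`. Suppose the restricted class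
`z₀` is algebraic, representing a local complete intersection `Z₀ ⊂ X₀` which is semi-regular in `X₀`. Then
for all `s ∈ S`, `z_s` is algebraic" (proof: "`Z₀` lifts to an analytic family over `U`, so `z_s` is algebraic
for `s ∈ U`"), `Z₀` being any local complete intersection of codimension `p` (§0) — NOT assumed irreducible.
RENDERING (module docstring): for a smooth projective family `f : 𝒳 ⟶ S` of relative dimension `n` over a
smooth quasi-projective `S`, `s₀ ∈ S(ℂ)`, `e : X₀ ≅ 𝒳_{s₀}` with `X₀` smooth projective of dimension `n`,
smooth projective `m`-folds `K_j` (`j : Fin r`, `m + p = n`) with closed immersions `ι_j : K_j ↪ X₀` of pairwise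
distinct images, a REDUCED closed lci `i : Z ↪ X₀` of codimension `p` with `|Z| = ⋃_j |ι_j(K_j)|` which is
Bloch-semiregular (`IsBlochSemiregular i n p`: `π : H¹(Z, 𝒩) → H^{p+1}(X₀, Ω^{p-1})` injective, as surjectivity
of its Serre dual), and a global class `W` fibrewise rational of type `(p,p)` with
`e^*(W|_{𝒳_{s₀}}) = [Z] = Σ_j ι_{j*}1_{K_j}` (`smoothSubvarietyClass`, complex orientations): the restrictions
`W|_{𝒳_t}` are algebraic for all `t` in an open neighbourhood of `s₀`. Sibling of `BlochSemiregularSpread n p`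
(integral `Z`, class pinned by support); here the class is pinned by the REAL fundamental class instead.
[cite: Bloch1972Semiregularity, §0, Thm. (7.4) and its proof, Remark (7.5)]
[cite: BuchweitzFlenner2003, Thm. 5.2 and proof of Cor. 4.12 ([Z] = ch_p(𝒪_Z)) and (8.1)–Prop. 8.2]
[cite: Fulton1998, §1.5 (cycle of a scheme) and §19.1] [cite: FultonYoungTableaux1997, Appendix B §B.3] -/
def BlochSemiregularSpreadSmoothComponents (n p : ℕ) : Prop :=
  ∀ (m : ℕ) (hmn : m + p = n) (X₀ : SchemeOver ℂ) (hX₀ : IsSmoothProjective n X₀)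
    (r : ℕ) (K : Fin r → SchemeOver ℂ) (hK : ∀ j, IsSmoothProjective m (K j)) (ι : ∀ j, K j ⟶ X₀)
    (Z : Scheme.{0}) (i : Z ⟶ X₀.left)
    (𝒳 S : SchemeOver ℂ) (f : 𝒳 ⟶ S) (s₀ : ComplexPoints S) (e : X₀ ≅ fiberOver f s₀)
    (W : complexBetti 𝒳 (2 * p)),
    (∀ j, IsClosedImmersion (ι j).left) →
    (∀ j j', Set.range (ι j).left.base = Set.range (ι j').left.base → j = j') →
    IsRegularImmersionOfCodim i p → IsReduced Z →
    Set.range i.base = ⋃ j, Set.range (ι j).left.base →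
    IsBlochSemiregular i n p →
    IsSmoothProjectiveFamily f n → IsQuasiProjectiveOver 𝒳 → IsQuasiProjectiveOver S →
    AlgebraicGeometry.Smooth S.hom →
    (∀ s : ComplexPoints S, IsRationalClass (complexBetti.map (fiberι f s) (2 * p) W) ∧
      IsOfHodgeType n (fiberOver f s) (2 * p) p p (complexBetti.map (fiberι f s) (2 * p) W)) →
    complexBetti.map e.hom (2 * p) (complexBetti.map (fiberι f s₀) (2 * p) W) =
      ∑ j, smoothSubvarietyClass hmn (hK j) hX₀ (ι j) →
    ∃ U : Set (ComplexPoints S), IsOpen U ∧ s₀ ∈ U ∧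
      ∀ t ∈ U, complexBetti.map (fiberι f t) (2 * p) W ∈ algebraicClasses (fiberOver f t) p

/-- The class hypothesis for ONE smooth component (`r = 1`, `Z = K` smooth, reduced, its own single
component): `e^*(W|_{s₀}) = ι_* 1_K`. Bookkeeping instance of the binder shape (the sum over `Fin 1`).
[cite: FultonYoungTableaux1997, Appendix B §B.3] -/
theorem sum_smoothSubvarietyClass_fin_one {m n p : ℕ} (hmn : m + p = n) {X₀ : SchemeOver ℂ}
    (hX₀ : IsSmoothProjective n X₀) (K : Fin 1 → SchemeOver ℂ) (hK : ∀ j, IsSmoothProjective m (K j))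
    (ι : ∀ j, K j ⟶ X₀) :
    ∑ j, smoothSubvarietyClass hmn (hK j) hX₀ (ι j) = smoothSubvarietyClass hmn (hK 0) hX₀ (ι 0) :=
  Fin.sum_univ_one _

end Statement

end Literature.AlgebraicGeometry.HodgeTheory

end
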